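import Literature.AlgebraicGeometry.Limits.SmoothProjectiveFamilyModel
import HarnessLib

/-!
# The smooth projective model of a family can be taken over a ring containing any prescribed
# finite set of scalars

Topic `Literature/AlgebraicGeometry/Limits` (EGA IV₃ §8; Maulik–Poonen 2012, §4). Complement to
`exists_smooth_projective_family_model_finiteType_int`: in the spreading-out of a smooth
`S`-projective family over an integral affine smooth `K`-scheme to a ring `R` of finite type over
`ℤ`, the ring `R → K` may be chosen so that its image contains any prescribed finite subset `F ⊆ K`
(e.g. the coefficients of the equations of an auxiliary cycle on one fibre, as in Maulik–Poonen's
argument: "by adjoining finitely many elements to `R` we may assume …"). Proof: take the model over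
`R` and base-change it along `R → R[F] ⊆ K`; closed subschemes of `ℙᴹ` base-change to closed
subschemes of `ℙᴹ` (`ProjBaseChangeRing.isPullback_projMap'`), smoothness, properness and the
cartesian squares are preserved.

Everything is proved; no definitions, no named facts.

## References

* [EGAIV3] A. Grothendieck, J. Dieudonné, EGA IV₃, Thm. 8.8.2 (ii).
* [MaulikPoonen2012] D. Maulik, B. Poonen, Néron–Severi groups under specialization, Duke Math.
  J. 161 (2012), §4.
-/

noncomputable section

universe u

open CategoryTheory CategoryTheory.Limits AlgebraicGeometry TopologicalSpace MonoidalCategory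
open MvPolynomial
open scoped TensorProduct

namespace Literature.AlgebraicGeometry.Limits

open Literature.AlgebraicGeometry.Motives
open Literature.AlgebraicGeometry.Motives.ProjBaseChangeRing (projToSpec)

set_option backward.isDefEq.respectTransparency false

/-- **Base change of a Proj-embedded smooth proper family with cartesian comparison squares**
(bookkeeping for `exists_smooth_projective_family_model_finiteType_int_finset`): given the data of
`exists_smooth_projective_family_model_finiteType_int` over `R → K` and an intermediate ring
`R → R' → K`, the same data exist over `R'` (base change along `Spec R' → Spec R`;
`ℙᴹ_{B} ×_B Spec B' = ℙᴹ_{B'}`). [cite: EGAIV3, Thm. 8.8.2 (ii)] -/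
theorem smooth_projective_family_model_baseChange {K : Type u} [Field K] {d n M : ℕ}
    (S : SchemeOver K) {𝒳 : SchemeOver K} (f : 𝒳 ⟶ S)
    {R : Type u} [CommRing R] [Algebra R K] {R' : Type u} [CommRing R'] [Algebra R R']
    [Algebra R' K] [IsScalarTower R R' K]
    {B : Type u} [CommRing B] [Algebra R B] [Algebra.FiniteType R B]
    (π : S.left ⟶ Spec (.of B)) {Y : Scheme.{u}} (g : Y ⟶ Spec (.of B))
    (emb : letI := MvPolynomial.gradedAlgebra (σ := Fin (M + 1)) (R := B)
      Y ⟶ Proj (homogeneousSubmodule (Fin (M + 1)) B)) [IsClosedImmersion emb]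
    (hembg : letI := MvPolynomial.gradedAlgebra (σ := Fin (M + 1)) (R := B)
      emb ≫ projToSpec (Fin (M + 1)) B = g)
    (π𝒳 : 𝒳.left ⟶ Y)
    (hBd : SmoothOfRelativeDimension d (Spec.map (CommRingCat.ofHom (algebraMap R B))))
    (Hπ : IsPullback π S.hom (Spec.map (CommRingCat.ofHom (algebraMap R B)))
      (Spec.map (CommRingCat.ofHom (algebraMap R K))))
    [IsProper g] (hgn : SmoothOfRelativeDimension n g) (H𝒳 : IsPullback π𝒳 f.left g π) :
    ∃ (B' : Type u) (_ : CommRing B') (_ : Algebra R' B') (_ : Algebra.FiniteType R' B')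
      (π' : S.left ⟶ Spec (.of B')) (Y' : Scheme.{u}) (g' : Y' ⟶ Spec (.of B'))
      (emb' : letI := MvPolynomial.gradedAlgebra (σ := Fin (M + 1)) (R := B')
        Y' ⟶ Proj (homogeneousSubmodule (Fin (M + 1)) B')) (_ : IsClosedImmersion emb')
      (_ : letI := MvPolynomial.gradedAlgebra (σ := Fin (M + 1)) (R := B')
        emb' ≫ projToSpec (Fin (M + 1)) B' = g')
      (π𝒳' : 𝒳.left ⟶ Y'),
      SmoothOfRelativeDimension d (Spec.map (CommRingCat.ofHom (algebraMap R' B'))) ∧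
      IsPullback π' S.hom (Spec.map (CommRingCat.ofHom (algebraMap R' B')))
        (Spec.map (CommRingCat.ofHom (algebraMap R' K))) ∧
      IsProper g' ∧ SmoothOfRelativeDimension n g' ∧ IsPullback π𝒳' f.left g' π' := by
  classical
  letI := MvPolynomial.gradedAlgebra (σ := Fin (M + 1)) (R := B)
  -- 1. the ring `B' = R' ⊗_R B` (kept opaque) with its two structure maps and its pushout square
  obtain ⟨B', _, _, _, hB'ft, sqB⟩ : ∃ (B' : Type u) (_ : CommRing B') (_ : Algebra R' B')
      (_ : Algebra B B'), Algebra.FiniteType R' B' ∧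
      IsPullback (Spec.map (CommRingCat.ofHom (algebraMap B B')))
        (Spec.map (CommRingCat.ofHom (algebraMap R' B')))
        (Spec.map (CommRingCat.ofHom (algebraMap R B)))
        (Spec.map (CommRingCat.ofHom (algebraMap R R'))) := by
    letI : Algebra B (R' ⊗[R] B) := Algebra.TensorProduct.rightAlgebra
    exact ⟨R' ⊗[R] B, inferInstance, inferInstance, inferInstance, inferInstance,
      isPullback_specMap_includeRight (K := R') (R := R) B⟩
  letI := MvPolynomial.gradedAlgebra (σ := Fin (M + 1)) (R := B')
  have hRK : Spec.map (CommRingCat.ofHom (algebraMap R K)) =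
      Spec.map (CommRingCat.ofHom (algebraMap R' K)) ≫
        Spec.map (CommRingCat.ofHom (algebraMap R R')) := by
    rw [← Spec.map_comp, ← CommRingCat.ofHom_comp, ← IsScalarTower.algebraMap_eq]
  -- 2. the base point `π' : S → Spec B'`
  have hwπ : π ≫ Spec.map (CommRingCat.ofHom (algebraMap R B)) =
      (S.hom ≫ Spec.map (CommRingCat.ofHom (algebraMap R' K))) ≫
        Spec.map (CommRingCat.ofHom (algebraMap R R')) := by
    rw [Category.assoc, ← hRK]; exact Hπ.w
  let π' : S.left ⟶ Spec (.of B') :=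
    sqB.lift π (S.hom ≫ Spec.map (CommRingCat.ofHom (algebraMap R' K))) hwπ
  have hπ'_fst : π' ≫ Spec.map (CommRingCat.ofHom (algebraMap B B')) = π := sqB.lift_fst _ _ hwπ
  have hπ'_snd : π' ≫ Spec.map (CommRingCat.ofHom (algebraMap R' B')) =
      S.hom ≫ Spec.map (CommRingCat.ofHom (algebraMap R' K)) := sqB.lift_snd _ _ hwπ
  have Hπ' : IsPullback π' S.hom (Spec.map (CommRingCat.ofHom (algebraMap R' B')))
      (Spec.map (CommRingCat.ofHom (algebraMap R' K))) := by
    refine IsPullback.of_right ?_ hπ'_snd sqB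
    rw [hπ'_fst, ← hRK]
    exact Hπ
  -- 3. the family `Y' = Y ×_B Spec B'` and its embedding into `ℙᴹ_{B'}`
  obtain ⟨prB, hprB⟩ : ∃ prB : Proj (homogeneousSubmodule (Fin (M + 1)) B) ⟶ Spec (.of B),
      prB = projToSpec (Fin (M + 1)) B := ⟨_, rfl⟩
  obtain ⟨prB', hprB'⟩ : ∃ prB' : Proj (homogeneousSubmodule (Fin (M + 1)) B') ⟶ Spec (.of B'),
      prB' = projToSpec (Fin (M + 1)) B' := ⟨_, rfl⟩
  have sqP : IsPullback (Proj.map _ (ProjBaseChangeRing.irrelevant_le_map B B' (Fin (M + 1)))) prB'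
      prB (Spec.map (CommRingCat.ofHom (algebraMap B B'))) := by
    rw [hprB, hprB']; exact ProjBaseChangeRing.isPullback_projMap' (k := B) (L := B') (n := M)
  have hembg' : emb ≫ prB = g := by rw [hprB]; exact hembg
  have sqY := IsPullback.of_hasPullback g (Spec.map (CommRingCat.ofHom (algebraMap B B')))
  let Y' : Scheme.{u} := pullback g (Spec.map (CommRingCat.ofHom (algebraMap B B')))
  let g' : Y' ⟶ Spec (.of B') := pullback.snd g (Spec.map (CommRingCat.ofHom (algebraMap B B')))
  have hw' : (pullback.fst g (Spec.map (CommRingCat.ofHom (algebraMap B B'))) ≫ emb) ≫ prB =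
      g' ≫ Spec.map (CommRingCat.ofHom (algebraMap B B')) := by
    rw [Category.assoc, hembg']; exact pullback.condition
  let emb' : Y' ⟶ Proj (homogeneousSubmodule (Fin (M + 1)) B') := sqP.lift _ _ hw'
  have hemb'_fst : emb' ≫ Proj.map _ (ProjBaseChangeRing.irrelevant_le_map B B' (Fin (M + 1))) =
      pullback.fst g (Spec.map (CommRingCat.ofHom (algebraMap B B'))) ≫ emb := sqP.lift_fst _ _ hw'
  have hemb'_snd : emb' ≫ prB' = g' := sqP.lift_snd _ _ hw'
  haveI : IsClosedImmersion emb' := by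
    have s : IsPullback (pullback.fst g (Spec.map (CommRingCat.ofHom (algebraMap B B'))))
        (emb' ≫ prB') (emb ≫ prB) (Spec.map (CommRingCat.ofHom (algebraMap B B'))) := by
      rw [hemb'_snd, hembg']; exact sqY
    have top : IsPullback (pullback.fst g (Spec.map (CommRingCat.ofHom (algebraMap B B')))) emb' emb
        (Proj.map _ (ProjBaseChangeRing.irrelevant_le_map B B' (Fin (M + 1)))) :=
      IsPullback.of_bot s hemb'_fst.symm sqP
    exact MorphismProperty.of_isPullback top inferInstance
  -- 4. properness, smoothness
  haveI : IsProper g' := inferInstance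
  haveI := smoothOfRelativeDimension_isStableUnderBaseChange (n := n)
  have hgn' : SmoothOfRelativeDimension n g' := MorphismProperty.of_isPullback sqY hgn
  haveI := smoothOfRelativeDimension_isStableUnderBaseChange (n := d)
  have hBd' : SmoothOfRelativeDimension d (Spec.map (CommRingCat.ofHom (algebraMap R' B'))) :=
    MorphismProperty.of_isPullback sqB hBd
  -- 5. the cartesian square for `𝒳`
  have hw𝒳 : π𝒳 ≫ g = (f.left ≫ π') ≫ Spec.map (CommRingCat.ofHom (algebraMap B B')) := by
    rw [Category.assoc, hπ'_fst]; exact H𝒳.w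
  let π𝒳' : 𝒳.left ⟶ Y' := pullback.lift π𝒳 (f.left ≫ π') hw𝒳
  have hπ𝒳'_fst : π𝒳' ≫ pullback.fst g (Spec.map (CommRingCat.ofHom (algebraMap B B'))) = π𝒳 :=
    pullback.lift_fst _ _ hw𝒳
  have hπ𝒳'_snd : π𝒳' ≫ g' = f.left ≫ π' := pullback.lift_snd _ _ hw𝒳
  have H𝒳' : IsPullback π𝒳' f.left g' π' := by
    refine IsPullback.of_right ?_ hπ𝒳'_snd sqY
    rw [hπ𝒳'_fst, hπ'_fst]
    exact H𝒳
  exact ⟨B', inferInstance, inferInstance, hB'ft, π', Y', g', emb', inferInstance,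
    by rw [← hprB']; exact hemb'_snd, π𝒳', hBd', Hπ', inferInstance, hgn', H𝒳'⟩

/-- **The ring of the model may contain any prescribed finite set of scalars** (EGA IV₃ §8;
Maulik–Poonen 2012, §4). As `exists_smooth_projective_family_model_finiteType_int`, for a field
`K`, an integral affine `K`-scheme `S` smooth of relative dimension `d`, `f : 𝒳 → S` smooth of
relative dimension `n` and a closed `S`-immersion `ι : 𝒳 ↪ S × ℙᴹ_K`; in addition, for a finite
`F ⊆ K`, the ring `R` of finite type over `ℤ` is chosen with `F` contained in the image of `R → K`.
[cite: EGAIV3, Thm. 8.8.2 (ii)] [cite: MaulikPoonen2012, §4] -/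
theorem exists_smooth_projective_family_model_finiteType_int_finset {K : Type u} [Field K]
    {d n M : ℕ} (S : SchemeOver K) [IsAffine S.left] [IsIntegral S.left]
    [SmoothOfRelativeDimension d S.hom] {𝒳 : SchemeOver K} (f : 𝒳 ⟶ S)
    [SmoothOfRelativeDimension n f.left] (ι : 𝒳 ⟶ S ⊗ projectiveSpace M K) [IsClosedImmersion ι.left]
    (hι : ι ≫ CartesianMonoidalCategory.fst S (projectiveSpace M K) = f) (F : Finset K) :
    ∃ (R : Type u) (_ : CommRing R) (_ : Algebra R K) (_ : Algebra.FiniteType ℤ R)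
      (B : Type u) (_ : CommRing B) (_ : Algebra R B) (_ : Algebra.FiniteType R B)
      (π : S.left ⟶ Spec (.of B)) (Y : Scheme.{u}) (g : Y ⟶ Spec (.of B))
      (emb : letI := MvPolynomial.gradedAlgebra (σ := Fin (M + 1)) (R := B)
        Y ⟶ Proj (homogeneousSubmodule (Fin (M + 1)) B)) (_ : IsClosedImmersion emb)
      (_ : letI := MvPolynomial.gradedAlgebra (σ := Fin (M + 1)) (R := B)
        emb ≫ projToSpec (Fin (M + 1)) B = g)
      (π𝒳 : 𝒳.left ⟶ Y),
      (∀ x ∈ F, x ∈ Set.range (algebraMap R K)) ∧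
      SmoothOfRelativeDimension d (Spec.map (CommRingCat.ofHom (algebraMap R B))) ∧
      IsPullback π S.hom (Spec.map (CommRingCat.ofHom (algebraMap R B)))
        (Spec.map (CommRingCat.ofHom (algebraMap R K))) ∧
      IsProper g ∧ SmoothOfRelativeDimension n g ∧ IsPullback π𝒳 f.left g π := by
  classical
  obtain ⟨R, _, _, _, B, _, _, _, π, Y, g, emb, _, hembg, π𝒳, hBd, Hπ, hgP, hgn, H𝒳⟩ :=
    exists_smooth_projective_family_model_finiteType_int (d := d) (n := n) S f ι hι
  -- the ring `R' = R[F] ⊆ K`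
  let R' : Subalgebra R K := Algebra.adjoin R (F : Set K)
  haveI : Algebra.FiniteType R R' :=
    (Subalgebra.fg_iff_finiteType _).mp ⟨F, rfl⟩
  haveI : Algebra.FiniteType ℤ R' :=
    Algebra.FiniteType.trans (inferInstance : Algebra.FiniteType ℤ R) inferInstance
  haveI := hgP
  obtain ⟨B', _, _, hB'ft, π', Y', g', emb', _, hembg', π𝒳', hBd', Hπ', hgP', hgn', H𝒳'⟩ :=
    smooth_projective_family_model_baseChange (R' := (R' : Type u)) S f π g emb hembg π𝒳 hBd Hπ hgn H𝒳
  refine ⟨R', inferInstance, inferInstance, inferInstance, B', inferInstance, inferInstance, hB'ft,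
    π', Y', g', emb', inferInstance, hembg', π𝒳', ?_, hBd', Hπ', hgP', hgn', H𝒳'⟩
  intro x hx
  exact ⟨⟨x, Algebra.subset_adjoin (by exact_mod_cast hx)⟩, rfl⟩

end Literature.AlgebraicGeometry.Limits

end
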